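import Literature.Analysis.Complex.PeakHerglotzKernel
import Mathlib.Analysis.Complex.AbsMax
import Mathlib.Analysis.Convex.Basic
import Mathlib.Topology.Algebra.Module.Basic
import HarnessLib

/-!
# Propagation of bounds between directions in a tube over a cone, by analytic discs

Topic `Literature/Analysis/Complex`. Let `V` be a real normed space, `Γ ⊆ V` a convex cone,
`J : V →L[ℝ] E` a real-linear map into a complex normed space (the points `J a + i J y`, `y ∈ Γ`,
form the *tube over `Γ`*), and `g` holomorphic on an open set containing the tube. The local
maximum modulus principle does not by itself compare the size of `g` near the *edge* `J(V)` in two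
different directions of approach `ô, k ∈ Γ`; this file proves the substitute that does:

* `norm_le_of_nearCone_of_disc` — **propagation lemma.** Fix `ô ∈ Γ`, a radius `ρ₀ > 0`, a compact
  set of target directions `K` with `K - [0, ε₀] ô ⊆ Γ`, and an excursion radius `Rx > 0`. There are
  `s₀ > 0` and a compact set `𝒴 ⊆ Γ` (depending only on these data) such that for every `g`
  holomorphic near the tube, every base point `x₀` and every `M`: if `‖g(J a + i J y)‖ ≤ M` for
  `‖a - x₀‖ ≤ Rx` and `y` in the truncated round cone `nearCone ô ρ₀ = (0, 1] · B(ô, ρ₀)`, and also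
  for `‖a - x₀‖ ≤ Rx`, `y ∈ 𝒴`, then `‖g(J x₀ + i s J k)‖ ≤ M` for all `k ∈ K`, `0 < s ≤ s₀`.

That is: a bound valid at *all small heights* in the directions near `ô`, together with a bound on a
*fixed compact part* of the tube (heights bounded below), propagates to all small heights in the
directions of `K`, with the same constant. The proof is the maximum modulus principle on one explicit
analytic disc `ζ ↦ J x₀ + Φ₁(ζ) · iJô + Φ₂(ζ) · iJk'` (`tubeDisc`) whose boundary lies in the two
regions and whose centre is `J x₀ + i s J k`: `Φ₂ = σ H_r`, `Φ₁ = g₀ H_{r₁}` with the peak-normalised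
Herglotz kernels of `PeakHerglotzKernel` (`H_r` has real part the peak-`1` Poisson bump of width
`ℓ = 1 - r` on the circle, `|H_r| ≤ 1` on the closed disc). On the arc where the bump `Re Φ₂` is at
least `σ/Q` the imaginary part `Re Φ₁ ô + Re Φ₂ k'` of the disc lies in the compact set
`𝒴 = [0,1]ô + [σ/Q, σ]K'`; on the rest of the circle the wider guard bump `Re Φ₁` (width `λℓ`)
dominates, `Re Φ₂ ‖k'‖ < ρ₀ Re Φ₁`, so the direction is within `ρ₀` of `ô` (the Lorentzian two-sided
bounds of `PeakHerglotzKernel` reduce this to `5λ²ℓ² < 40ℓ² + 3θ²` for `θ² > (2λ² - 1)ℓ²`); the real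
parts `Im Φⱼ` stay bounded by `g₀‖ô‖ + σ‖k'‖ ≤ Rx` (this is where the normalisation `|H_r| ≤ 1`,
uniform in `r`, matters: the width `ℓ ∝ s` shrinks with the target height while all other parameters
stay fixed). The centre works out as `g₀ℓ₁/(2-ℓ₁) ô + s k'`, and `k' := k - ε' ô` is chosen to make
it exactly `s k`.

This is the geometric step of the theorem "ray-wise distributional boundary values of a holomorphic
function on a tube force locally uniform polynomial growth at the edge"
(`Literature/Analysis/Distribution/RayBoundaryValueGrowth.lean`), the several-variable companion of
Hörmander, *ALPDO I*, Thm. 3.1.14. The disc argument is standard several-complex-variables technique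
(analytic discs attached to a tube, cf. the proofs of Bochner's tube theorem, Hörmander, *An
Introduction to Complex Analysis in Several Variables*, Thm. 2.5.10); no published source states the
lemma in this form. [folklore]

## Mathlib

Used: `Complex.norm_le_of_forall_mem_frontier_norm_le` (maximum modulus principle on a bounded
domain), `DifferentiableOn.diffContOnCl`, `frontier_ball`, `isBounded_iff_forall_norm_le`.
-/

noncomputable section

open Metric Set Filter
open _root_.Complex

namespace Literature.Analysis.Complex

variable {V : Type*} [NormedAddCommGroup V] [NormedSpace ℝ V]
variable {E : Type*} [NormedAddCommGroup E] [NormedSpace ℂ E]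

/-! ### Cone arithmetic -/

/-- A convex set closed under positive dilations is closed under addition. [folklore] -/
theorem add_mem_of_convex_cone {Γ : Set V} (hΓc : Convex ℝ Γ)
    (hΓcone : ∀ c : ℝ, 0 < c → ∀ y ∈ Γ, c • y ∈ Γ) {a b : V} (ha : a ∈ Γ) (hb : b ∈ Γ) :
    a + b ∈ Γ := by
  have h := hΓc (hΓcone 2 two_pos a ha) (hΓcone 2 two_pos b hb)
    (show (0 : ℝ) ≤ 2⁻¹ by norm_num) (show (0 : ℝ) ≤ 2⁻¹ by norm_num) (by norm_num)
  have heq : a + b = (2 : ℝ)⁻¹ • ((2 : ℝ) • a) + (2 : ℝ)⁻¹ • ((2 : ℝ) • b) := by module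
  rw [heq]; exact h

/-- `p ô + q k ∈ Γ` for `ô, k` in a convex cone `Γ`, `p ≥ 0`, `q > 0`. [folklore] -/
theorem smul_add_smul_mem_of_convex_cone {Γ : Set V} (hΓc : Convex ℝ Γ)
    (hΓcone : ∀ c : ℝ, 0 < c → ∀ y ∈ Γ, c • y ∈ Γ) {ô k : V} (hô : ô ∈ Γ) (hk : k ∈ Γ)
    {p q : ℝ} (hp : 0 ≤ p) (hq : 0 < q) : p • ô + q • k ∈ Γ := by
  rcases hp.eq_or_lt with rfl | hp'
  · simpa using hΓcone q hq k hk
  · exact add_mem_of_convex_cone hΓc hΓcone (hΓcone p hp' ô hô) (hΓcone q hq k hk)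

/-! ### The truncated round cone of directions -/

/-- The **truncated round cone** `(0, 1] · B(ô, ρ₀)`: the vectors `t η` with `0 < t ≤ 1` and
`‖η - ô‖ < ρ₀` (all small multiples of the directions `ρ₀`-close to `ô`). [folklore] -/
def nearCone (ô : V) (ρ₀ : ℝ) : Set V :=
  {y | ∃ t ∈ Ioc (0 : ℝ) 1, ∃ η ∈ ball ô ρ₀, y = t • η}

/-- Membership in `nearCone` from a decomposition `y = A₁ ô + A₂ k'` with `0 < A₁ ≤ 1` and
`A₂ ‖k'‖ < ρ₀ A₁`. [folklore] -/
theorem smul_add_smul_mem_nearCone {ô k' : V} {ρ₀ A₁ A₂ : ℝ} (hA₁ : 0 < A₁) (hA₁1 : A₁ ≤ 1)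
    (hA₂ : 0 ≤ A₂) (hlt : A₂ * ‖k'‖ < ρ₀ * A₁) : A₁ • ô + A₂ • k' ∈ nearCone ô ρ₀ := by
  refine ⟨A₁, ⟨hA₁, hA₁1⟩, ô + (A₂ / A₁) • k', ?_, ?_⟩
  · rw [mem_ball, dist_eq_norm, add_sub_cancel_left, norm_smul, Real.norm_eq_abs,
      abs_of_nonneg (div_nonneg hA₂ hA₁.le), div_mul_eq_mul_div, div_lt_iff₀ hA₁]
    exact hlt
  · rw [smul_add, smul_smul, mul_div_cancel₀ _ hA₁.ne']

/-! ### The analytic disc -/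

/-- The **analytic disc attached to the tube**: `ζ ↦ J x₀ + Φ₁(ζ) · (i J ô) + Φ₂(ζ) · (i J k')`,
a holomorphic curve in `E` when `Φ₁, Φ₂` are holomorphic. [folklore] -/
def tubeDisc (J : V →L[ℝ] E) (x₀ ô k' : V) (Φ₁ Φ₂ : ℂ → ℂ) (ζ : ℂ) : E :=
  J x₀ + Φ₁ ζ • ((I : ℂ) • J ô) + Φ₂ ζ • ((I : ℂ) • J k')

/-- A complex multiple of `i J v` in terms of real and imaginary parts:
`Φ · (i Jv) = i J(Re Φ · v) - J(Im Φ · v)`. [folklore] -/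
theorem smul_I_smul_eq (J : V →L[ℝ] E) (Φ : ℂ) (v : V) :
    Φ • ((I : ℂ) • J v) = (I : ℂ) • J (Φ.re • v) - J (Φ.im • v) := by
  rw [J.map_smul, J.map_smul, ← Complex.coe_smul, ← Complex.coe_smul, smul_smul, smul_smul]
  conv_lhs => rw [← re_add_im Φ]
  have h : ((Φ.re : ℂ) + Φ.im * I) * I = I * Φ.re - Φ.im := by
    ring_nf; rw [I_sq]; ring
  rw [h, sub_smul]

/-- **Real form of the disc**: `tubeDisc J x₀ ô k' Φ₁ Φ₂ ζ = J a + i J y` with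
`a = x₀ - Im Φ₁(ζ) ô - Im Φ₂(ζ) k'` and `y = Re Φ₁(ζ) ô + Re Φ₂(ζ) k'`. [folklore] -/
theorem tubeDisc_eq (J : V →L[ℝ] E) (x₀ ô k' : V) (Φ₁ Φ₂ : ℂ → ℂ) (ζ : ℂ) :
    tubeDisc J x₀ ô k' Φ₁ Φ₂ ζ =
      J (x₀ - (Φ₁ ζ).im • ô - (Φ₂ ζ).im • k') +
        (I : ℂ) • J ((Φ₁ ζ).re • ô + (Φ₂ ζ).re • k') := by
  rw [tubeDisc, smul_I_smul_eq, smul_I_smul_eq, map_sub, map_sub, map_add, smul_add]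
  abel

/-- The disc is holomorphic where `Φ₁, Φ₂` are. [folklore] -/
theorem differentiableAt_tubeDisc (J : V →L[ℝ] E) (x₀ ô k' : V) {Φ₁ Φ₂ : ℂ → ℂ} {ζ : ℂ}
    (h₁ : DifferentiableAt ℂ Φ₁ ζ) (h₂ : DifferentiableAt ℂ Φ₂ ζ) :
    DifferentiableAt ℂ (tubeDisc J x₀ ô k' Φ₁ Φ₂) ζ :=
  ((differentiableAt_const _).add (h₁.smul_const _)).add (h₂.smul_const _)

/-! ### Real-variable bookkeeping for the disc -/

/-- Zone B arithmetic: with `ρ₀ g₀ λ² = 8 σ B` and `θ² > (2λ² - 1) ℓ²`,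
`σ B ℓ²/(ℓ² + θ²/5) < ρ₀ g₀ (λℓ)²/((λℓ)² + θ²)`. [folklore] -/
theorem disc_zoneB_ineq {σ B ℓ lam θ ρ₀ g₀ : ℝ} (hσ : 0 < σ) (hB : 0 < B) (hℓ : 0 < ℓ)
    (hlam : 0 < lam) (hkey : ρ₀ * g₀ * lam ^ 2 = 8 * σ * B) (hfar : (2 * lam ^ 2 - 1) * ℓ ^ 2 < θ ^ 2) :
    σ * B * ℓ ^ 2 / (ℓ ^ 2 + θ ^ 2 / 5) < ρ₀ * g₀ * (lam * ℓ) ^ 2 / ((lam * ℓ) ^ 2 + θ ^ 2) := by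
  have hD1 : 0 < ℓ ^ 2 + θ ^ 2 / 5 := by positivity
  have hD2 : 0 < (lam * ℓ) ^ 2 + θ ^ 2 := by positivity
  have hP : 0 ≤ lam ^ 2 * ℓ ^ 2 := by positivity
  have h5 : (lam * ℓ) ^ 2 + θ ^ 2 < 8 * (ℓ ^ 2 + θ ^ 2 / 5) := by
    rw [mul_pow]; nlinarith [hfar, hP, sq_nonneg ℓ, sq_nonneg θ]
  have hc : 0 < σ * B * ℓ ^ 2 := by positivity
  have hrw : ρ₀ * g₀ * (lam * ℓ) ^ 2 = 8 * (σ * B * ℓ ^ 2) := by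
    rw [mul_pow, ← mul_assoc, hkey]; ring
  rw [hrw, div_lt_div_iff₀ hD1 hD2]
  have := mul_lt_mul_of_pos_left h5 hc
  linarith

/-- The correction `ε' = (g₀/σ)(ℓ₁/(2-ℓ₁))((2-ℓ)/ℓ)` is at most `ε₀` when `ℓ₁ = λℓ ≤ 1/4`,
`ρ₀ g₀ λ² = 8 σ B` (so that `(g₀/σ) λ = 8B/(ρ₀λ)`) and `22 B ≤ λ ρ₀ ε₀`. [folklore] -/
theorem disc_eps_le {σ B ℓ lam ρ₀ g₀ ε₀ : ℝ} (hσ : 0 < σ) (hB : 0 < B) (hℓ : 0 < ℓ)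
    (hlam : 0 < lam) (hρ₀ : 0 < ρ₀) (hε₀ : 0 < ε₀) (hℓ₁ : lam * ℓ ≤ 1 / 4)
    (hkey : ρ₀ * g₀ * lam ^ 2 = 8 * σ * B) (hlamB : 22 * B ≤ lam * (ρ₀ * ε₀)) :
    (g₀ / σ) * (lam * ℓ / (2 - lam * ℓ)) * ((2 - ℓ) / ℓ) ≤ ε₀ := by
  have h1 : (g₀ / σ) * (lam * ℓ / (2 - lam * ℓ)) * ((2 - ℓ) / ℓ) =
      (g₀ / σ * lam) * ((2 - ℓ) / (2 - lam * ℓ)) := by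
    field_simp
  have h2 : (2 - ℓ) / (2 - lam * ℓ) ≤ 8 / 7 := by
    rw [div_le_div_iff₀ (by linarith) (by norm_num)]; linarith
  have h3 : g₀ / σ * lam = 8 * B / (ρ₀ * lam) := by
    field_simp
    linear_combination hkey
  have h4 : B / (ρ₀ * lam) ≤ ε₀ / 22 := by
    rw [div_le_div_iff₀ (by positivity) (by norm_num)]; linarith
  rw [h1, h3]
  calc 8 * B / (ρ₀ * lam) * ((2 - ℓ) / (2 - lam * ℓ)) ≤ 8 * B / (ρ₀ * lam) * (8 / 7) :=
        mul_le_mul_of_nonneg_left h2 (by positivity)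
    _ = 64 / 7 * (B / (ρ₀ * lam)) := by ring
    _ ≤ 64 / 7 * (ε₀ / 22) := by gcongr
    _ ≤ ε₀ := by linarith

/-- The centre identity: with `σ ℓ = s (2 - ℓ)` and `ε'` as above,
`g₀ ℓ₁/(2 - ℓ₁) = s ε'`. [folklore] -/
theorem disc_centre_coeff {σ ℓ ℓ₁ g₀ s : ℝ} (hσ : 0 < σ) (hℓ : 0 < ℓ) (hℓ₁ : ℓ₁ < 2)
    (hkey : σ * ℓ = s * (2 - ℓ)) :
    g₀ * (ℓ₁ / (2 - ℓ₁)) = s * ((g₀ / σ) * (ℓ₁ / (2 - ℓ₁)) * ((2 - ℓ) / ℓ)) := by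
  have h2 : (2 : ℝ) - ℓ₁ ≠ 0 := by linarith
  field_simp
  linear_combination g₀ * ℓ₁ * hkey

/-! ### The propagation lemma -/

/-- **Propagation of bounds from the directions near `ô` to the directions in `K`.** Let `Γ` be a
convex cone in `V`, `ô ∈ Γ`, `ρ₀ > 0`, `K` compact with `k - ε ô ∈ Γ` for `k ∈ K`, `0 ≤ ε ≤ ε₀`
(`ε₀ > 0`), and `Rx > 0`. Then there are `s₀ > 0` and a compact `𝒴 ⊆ Γ` such that for every
real-linear `J : V → E`, every `g` holomorphic on an open set containing the tube
`{J a + i J y : y ∈ Γ}`, every `x₀ ∈ V` and `M ∈ ℝ`: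

  `‖g(J a + i J y)‖ ≤ M` for `‖a - x₀‖ ≤ Rx`, `y ∈ nearCone ô ρ₀`, and
  `‖g(J a + i J y)‖ ≤ M` for `‖a - x₀‖ ≤ Rx`, `y ∈ 𝒴`
  `⟹ ‖g(J x₀ + i s J k)‖ ≤ M` for all `k ∈ K`, `0 < s ≤ s₀`.

Proof: maximum modulus on the analytic disc `tubeDisc J x₀ ô (k - ε'ô) (g₀ H_{r₁}) (σ H_r)` with
`ℓ = 1 - r = 2s/(σ + s)`, `1 - r₁ = λℓ`; see the module docstring for the bookkeeping. [folklore] -/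
theorem norm_le_of_nearCone_of_disc {Γ : Set V} (hΓc : Convex ℝ Γ)
    (hΓcone : ∀ c : ℝ, 0 < c → ∀ y ∈ Γ, c • y ∈ Γ) {ô : V} (hô : ô ∈ Γ) {ρ₀ : ℝ} (hρ₀ : 0 < ρ₀)
    {K : Set V} (hK : IsCompact K) {ε₀ : ℝ} (hε₀ : 0 < ε₀)
    (hKΓ : ∀ k ∈ K, ∀ ε ∈ Icc (0 : ℝ) ε₀, k - ε • ô ∈ Γ) {Rx : ℝ} (hRx : 0 < Rx) :
    ∃ s₀ : ℝ, 0 < s₀ ∧ ∃ 𝒴 : Set V, IsCompact 𝒴 ∧ 𝒴 ⊆ Γ ∧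
      ∀ (J : V →L[ℝ] E) (U : Set E), IsOpen U → (∀ a : V, ∀ y ∈ Γ, J a + (I : ℂ) • J y ∈ U) →
      ∀ g : E → ℂ, DifferentiableOn ℂ g U → ∀ (x₀ : V) (M : ℝ),
        (∀ a y, ‖a - x₀‖ ≤ Rx → y ∈ nearCone ô ρ₀ → ‖g (J a + (I : ℂ) • J y)‖ ≤ M) →
        (∀ a y, ‖a - x₀‖ ≤ Rx → y ∈ 𝒴 → ‖g (J a + (I : ℂ) • J y)‖ ≤ M) →
        ∀ k ∈ K, ∀ s : ℝ, 0 < s → s ≤ s₀ → ‖g (J x₀ + (I : ℂ) • J (s • k))‖ ≤ M := by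
  -- the compact set of auxiliary directions `K' = K - [0, ε₀] ô ⊆ Γ` and a bound `B ≥ 1` for it
  set K' : Set V := (fun p : V × ℝ => p.1 - p.2 • ô) '' (K ×ˢ Icc (0 : ℝ) ε₀) with hK'def
  have hK'c : IsCompact K' := (hK.prod isCompact_Icc).image (by fun_prop)
  have hK'Γ : K' ⊆ Γ := by
    rintro _ ⟨⟨k, ε⟩, ⟨hk, hε⟩, rfl⟩
    exact hKΓ k hk ε hε
  obtain ⟨B, hB1, hBK'⟩ : ∃ B : ℝ, 1 ≤ B ∧ ∀ k'' ∈ K', ‖k''‖ ≤ B := by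
    obtain ⟨C, hC⟩ := isBounded_iff_forall_norm_le.1 hK'c.isBounded
    exact ⟨max C 1, le_max_right _ _, fun k'' hk'' => (hC k'' hk'').trans (le_max_left _ _)⟩
  have hB0 : 0 < B := lt_of_lt_of_le one_pos hB1
  -- the parameters independent of the target height
  obtain ⟨lam, hlam3, hlamB⟩ : ∃ lam : ℝ, 3 ≤ lam ∧ 22 * B ≤ lam * (ρ₀ * ε₀) := by
    refine ⟨max 3 (22 * B / (ρ₀ * ε₀)), le_max_left _ _, ?_⟩
    have h := le_max_right 3 (22 * B / (ρ₀ * ε₀))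
    rwa [div_le_iff₀ (by positivity)] at h
  have hlam0 : 0 < lam := by linarith
  obtain ⟨σ, hσ0, hσB, hσg, hσô⟩ : ∃ σ : ℝ, 0 < σ ∧ σ * B ≤ Rx / 2 ∧
      8 * σ * B / (ρ₀ * lam ^ 2) ≤ 1 ∧ 8 * σ * B / (ρ₀ * lam ^ 2) * ‖ô‖ ≤ Rx / 2 := by
    refine ⟨min (Rx / (2 * B)) (min (ρ₀ * lam ^ 2 / (8 * B))
      (Rx * ρ₀ * lam ^ 2 / (16 * B * (‖ô‖ + 1)))), by positivity, ?_, ?_, ?_⟩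
    · have h := min_le_left (Rx / (2 * B)) (min (ρ₀ * lam ^ 2 / (8 * B))
        (Rx * ρ₀ * lam ^ 2 / (16 * B * (‖ô‖ + 1))))
      rw [le_div_iff₀ (by positivity)] at h
      linarith
    · have h := (min_le_right (Rx / (2 * B)) _).trans (min_le_left (ρ₀ * lam ^ 2 / (8 * B))
        (Rx * ρ₀ * lam ^ 2 / (16 * B * (‖ô‖ + 1))))
      rw [le_div_iff₀ (by positivity)] at h
      rw [div_le_one (by positivity)]
      linarith
    · have h := (min_le_right (Rx / (2 * B)) _).trans (min_le_right (ρ₀ * lam ^ 2 / (8 * B))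
        (Rx * ρ₀ * lam ^ 2 / (16 * B * (‖ô‖ + 1))))
      rw [le_div_iff₀ (by positivity)] at h
      rw [div_mul_eq_mul_div, div_le_iff₀ (by positivity)]
      have hô0 : 0 ≤ ‖ô‖ := norm_nonneg ô
      set m := min (Rx / (2 * B)) (min (ρ₀ * lam ^ 2 / (8 * B))
        (Rx * ρ₀ * lam ^ 2 / (16 * B * (‖ô‖ + 1))))
      have hm : 0 ≤ m := by positivity
      nlinarith [mul_nonneg hm hô0]
  set g₀ : ℝ := 8 * σ * B / (ρ₀ * lam ^ 2) with hg₀def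
  have hg₀0 : 0 < g₀ := by positivity
  have hg₀key : ρ₀ * g₀ * lam ^ 2 = 8 * σ * B := by
    rw [hg₀def]; field_simp
  have hg₀1 : g₀ ≤ 1 := hσg
  have hg₀ô : g₀ * ‖ô‖ ≤ Rx / 2 := hσô
  clear_value g₀
  -- the compact set `𝒴 = [0, 1] ô + [σ/Q, σ] K'`, `Q = 2λ²`
  set 𝒴 : Set V := (fun p : ℝ × ℝ × V => p.1 • ô + p.2.1 • p.2.2) ''
    (Icc (0 : ℝ) 1 ×ˢ Icc (σ / (2 * lam ^ 2)) σ ×ˢ K') with h𝒴def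
  have h𝒴c : IsCompact 𝒴 :=
    (isCompact_Icc.prod (isCompact_Icc.prod hK'c)).image (by fun_prop)
  have h𝒴Γ : 𝒴 ⊆ Γ := by
    rintro _ ⟨⟨p, q, k''⟩, ⟨hp, hq, hk''⟩, rfl⟩
    exact smul_add_smul_mem_of_convex_cone hΓc hΓcone hô (hK'Γ hk'') hp.1
      (lt_of_lt_of_le (by positivity) hq.1)
  refine ⟨σ / (8 * lam), by positivity, 𝒴, h𝒴c, h𝒴Γ, ?_⟩
  intro J U hU htube g hg x₀ M hO h𝒴 k hk s hs0 hs1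
  -- the widths `ℓ = 2s/(σ + s)` and `ℓ₁ = λ ℓ`
  obtain ⟨ℓ, hℓ0, hℓkey, hℓle⟩ : ∃ ℓ : ℝ, 0 < ℓ ∧ σ * ℓ = s * (2 - ℓ) ∧ ℓ ≤ 1 / (4 * lam) := by
    refine ⟨2 * s / (σ + s), by positivity, by field_simp; ring, ?_⟩
    have h1 : 2 * s / (σ + s) ≤ 2 * s / σ := by gcongr; linarith
    refine h1.trans ?_
    rw [div_le_div_iff₀ hσ0 (by positivity)]
    rw [le_div_iff₀ (by positivity)] at hs1
    linarith
  have hℓ₁le : lam * ℓ ≤ 1 / 4 :=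
    calc lam * ℓ ≤ lam * (1 / (4 * lam)) := mul_le_mul_of_nonneg_left hℓle hlam0.le
      _ = 1 / 4 := by field_simp
  have hℓsmall : ℓ ≤ 1 / 12 := by nlinarith
  set r : ℝ := 1 - ℓ with hrdef
  have hr1 : r < 1 := by rw [hrdef]; linarith
  have hr0 : (1 : ℝ) / 2 ≤ r := by rw [hrdef]; linarith
  have hr0' : 0 < r := by linarith
  set r₁ : ℝ := 1 - lam * ℓ with hr₁def
  have hr₁1 : r₁ < 1 := by rw [hr₁def]; nlinarith
  have hr₁0 : (1 : ℝ) / 2 ≤ r₁ := by rw [hr₁def]; linarith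
  have hr₁0' : 0 < r₁ := by linarith
  -- the correction `ε'` and the auxiliary direction `k' = k - ε' ô ∈ K'`
  set ε' : ℝ := (g₀ / σ) * (lam * ℓ / (2 - lam * ℓ)) * ((2 - ℓ) / ℓ) with hε'def
  have hε'0 : 0 ≤ ε' := by
    rw [hε'def]
    refine mul_nonneg (mul_nonneg (by positivity) (div_nonneg (by positivity) (by linarith)))
      (div_nonneg (by linarith) hℓ0.le)
  have hε'le : ε' ≤ ε₀ := disc_eps_le hσ0 hB0 hℓ0 hlam0 hρ₀ hε₀ hℓ₁le hg₀key hlamB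
  have hcentre : g₀ * (lam * ℓ / (2 - lam * ℓ)) = s * ε' :=
    disc_centre_coeff hσ0 hℓ0 (by linarith) hℓkey
  clear_value ε'
  set k' : V := k - ε' • ô with hk'def
  have hk'K' : k' ∈ K' := ⟨(k, ε'), ⟨hk, hε'0, hε'le⟩, rfl⟩
  have hk'Γ : k' ∈ Γ := hK'Γ hk'K'
  have hk'B : ‖k'‖ ≤ B := hBK' k' hk'K'
  -- the disc
  set Φ₁ : ℂ → ℂ := fun ζ => (g₀ : ℂ) * peakKernel r₁ ζ with hΦ₁def
  set Φ₂ : ℂ → ℂ := fun ζ => (σ : ℂ) * peakKernel r ζ with hΦ₂def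
  have hΦ₁re : ∀ ζ, (Φ₁ ζ).re = g₀ * (peakKernel r₁ ζ).re := fun ζ => by
    simp [hΦ₁def]
  have hΦ₂re : ∀ ζ, (Φ₂ ζ).re = σ * (peakKernel r ζ).re := fun ζ => by
    simp [hΦ₂def]
  have hΦ₁im : ∀ ζ, (Φ₁ ζ).im = g₀ * (peakKernel r₁ ζ).im := fun ζ => by
    simp [hΦ₁def]
  have hΦ₂im : ∀ ζ, (Φ₂ ζ).im = σ * (peakKernel r ζ).im := fun ζ => by
    simp [hΦ₂def]
  set z : ℂ → E := tubeDisc J x₀ ô k' Φ₁ Φ₂ with hzdef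
  -- a disc of radius `R' > 1` on which the disc stays inside the tube
  set R' : ℝ := min r⁻¹ r₁⁻¹ with hR'def
  have hR'1 : 1 < R' := lt_min ((one_lt_inv₀ hr0').2 hr1) ((one_lt_inv₀ hr₁0').2 hr₁1)
  have hzU : ∀ ζ : ℂ, ‖ζ‖ < R' → z ζ ∈ U := by
    intro ζ hζ
    rw [hzdef, tubeDisc_eq]
    refine htube _ _ (smul_add_smul_mem_of_convex_cone hΓc hΓcone hô hk'Γ ?_ ?_)
    · rw [hΦ₁re]
      exact (mul_pos hg₀0 (peakKernel_re_pos hr₁0' hr₁1 (hζ.trans_le (min_le_right _ _)))).le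
    · rw [hΦ₂re]
      exact mul_pos hσ0 (peakKernel_re_pos hr0' hr1 (hζ.trans_le (min_le_left _ _)))
  have hGd : DifferentiableOn ℂ (g ∘ z) (ball (0 : ℂ) R') := by
    intro ζ hζ
    rw [mem_ball_zero_iff] at hζ
    refine DifferentiableAt.differentiableWithinAt ?_
    refine (hg.differentiableAt (hU.mem_nhds (hzU ζ hζ))).comp ζ ?_
    refine differentiableAt_tubeDisc J x₀ ô k' ?_ ?_
    · exact (differentiableAt_const _).mul
        (differentiableAt_peakKernel hr₁0' (hζ.trans_le (min_le_right _ _)))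
    · exact (differentiableAt_const _).mul
        (differentiableAt_peakKernel hr0' (hζ.trans_le (min_le_left _ _)))
  have hGdc : DiffContOnCl ℂ (g ∘ z) (ball (0 : ℂ) 1) := by
    refine DifferentiableOn.diffContOnCl (hGd.mono ?_)
    rw [closure_ball (0 : ℂ) one_ne_zero]
    exact closedBall_subset_ball hR'1
  -- the bound on the boundary circle
  have hbdry : ∀ ζ ∈ frontier (ball (0 : ℂ) 1), ‖(g ∘ z) ζ‖ ≤ M := by
    intro ζ hζ
    rw [frontier_ball (0 : ℂ) one_ne_zero, mem_sphere_zero_iff_norm] at hζ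
    have hζ1 : ‖ζ‖ ≤ 1 := hζ.le
    have hpk₁ := peakKernel_re_mem_Icc hr₁0' hr₁1 hζ1
    have hpk₂ := peakKernel_re_mem_Icc hr0' hr1 hζ1
    have hA₁pos : 0 < (Φ₁ ζ).re := by
      rw [hΦ₁re]
      exact mul_pos hg₀0
        (peakKernel_re_pos hr₁0' hr₁1 (hζ1.trans_lt ((one_lt_inv₀ hr₁0').2 hr₁1)))
    have hA₁le : (Φ₁ ζ).re ≤ g₀ := by
      rw [hΦ₁re]; exact mul_le_of_le_one_right hg₀0.le hpk₁.2
    have hA₂nn : 0 ≤ (Φ₂ ζ).re := by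
      rw [hΦ₂re]; exact mul_nonneg hσ0.le hpk₂.1
    have hA₂le : (Φ₂ ζ).re ≤ σ := by
      rw [hΦ₂re]; exact mul_le_of_le_one_right hσ0.le hpk₂.2
    -- the excursion of the real part
    have hexc : ‖(x₀ - (Φ₁ ζ).im • ô - (Φ₂ ζ).im • k') - x₀‖ ≤ Rx := by
      have hre : x₀ - (Φ₁ ζ).im • ô - (Φ₂ ζ).im • k' - x₀ = -((Φ₁ ζ).im • ô + (Φ₂ ζ).im • k') := by
        abel
      rw [hre, norm_neg]
      refine (norm_add_le _ _).trans ?_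
      rw [norm_smul, norm_smul, Real.norm_eq_abs, Real.norm_eq_abs, hΦ₁im, hΦ₂im, abs_mul,
        abs_mul, abs_of_pos hg₀0, abs_of_pos hσ0]
      have h1 : g₀ * |(peakKernel r₁ ζ).im| * ‖ô‖ ≤ g₀ * ‖ô‖ := by
        refine mul_le_mul_of_nonneg_right ?_ (norm_nonneg ô)
        exact mul_le_of_le_one_right hg₀0.le (abs_peakKernel_im_le_one hr₁0' hr₁1 hζ1)
      have h2 : σ * |(peakKernel r ζ).im| * ‖k'‖ ≤ σ * B := by
        calc σ * |(peakKernel r ζ).im| * ‖k'‖ ≤ σ * 1 * B :=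
              mul_le_mul (mul_le_mul_of_nonneg_left (abs_peakKernel_im_le_one hr0' hr1 hζ1)
                hσ0.le) hk'B (norm_nonneg _) (by positivity)
          _ = σ * B := by ring
      linarith
    change ‖g (z ζ)‖ ≤ M
    rw [hzdef, tubeDisc_eq]
    rcases peakKernel_re_ge_or_far hr0' hr1 (by positivity : (0 : ℝ) < 2 * lam ^ 2) hζ with
      hcase | ⟨θ, hθπ, rfl, hfar⟩
    · -- zone A: the bump is at least `σ/Q`, the point lies over `𝒴`
      refine h𝒴 _ _ hexc ⟨((Φ₁ ζ).re, (Φ₂ ζ).re, k'),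
        ⟨⟨hA₁pos.le, hA₁le.trans hg₀1⟩, ⟨?_, hA₂le⟩, hk'K'⟩, rfl⟩
      rw [hΦ₂re]
      calc σ / (2 * lam ^ 2) = σ * (1 / (2 * lam ^ 2)) := by ring
        _ ≤ σ * (peakKernel r ζ).re := mul_le_mul_of_nonneg_left hcase hσ0.le
    · -- zone B: far out in the tail, the guard bump dominates and the direction is near `ô`
      have hℓr : 1 - r = ℓ := by rw [hrdef]; ring
      have hℓr₁ : 1 - r₁ = lam * ℓ := by rw [hr₁def]; ring
      rw [hℓr] at hfar
      have hup := peakKernel_exp_re_le_lorentz hr0 hr1 hθπ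
      have hlow := lorentz_le_peakKernel_exp_re hr₁0' hr₁1 θ
      rw [hℓr] at hup
      rw [hℓr₁] at hlow
      have key : (Φ₂ (cexp (θ * I))).re * ‖k'‖ < ρ₀ * (Φ₁ (cexp (θ * I))).re :=
        calc (Φ₂ (cexp (θ * I))).re * ‖k'‖ ≤ σ * (ℓ ^ 2 / (ℓ ^ 2 + θ ^ 2 / 5)) * B := by
              refine mul_le_mul ?_ hk'B (norm_nonneg _) (by positivity)
              rw [hΦ₂re]
              exact mul_le_mul_of_nonneg_left hup hσ0.le
          _ = σ * B * ℓ ^ 2 / (ℓ ^ 2 + θ ^ 2 / 5) := by ring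
          _ < ρ₀ * g₀ * (lam * ℓ) ^ 2 / ((lam * ℓ) ^ 2 + θ ^ 2) :=
              disc_zoneB_ineq hσ0 hB0 hℓ0 hlam0 hg₀key hfar
          _ = ρ₀ * (g₀ * ((lam * ℓ) ^ 2 / ((lam * ℓ) ^ 2 + θ ^ 2))) := by ring
          _ ≤ ρ₀ * (Φ₁ (cexp (θ * I))).re := by
              refine mul_le_mul_of_nonneg_left ?_ hρ₀.le
              rw [hΦ₁re]
              exact mul_le_mul_of_nonneg_left hlow hg₀0.le
      exact hO _ _ hexc (smul_add_smul_mem_nearCone hA₁pos (hA₁le.trans hg₀1) hA₂nn key)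
  -- the maximum modulus principle on the disc, and the centre of the disc
  have hmax := Complex.norm_le_of_forall_mem_frontier_norm_le isBounded_ball hGdc hbdry
    (subset_closure (mem_ball_self one_pos))
  have h2ℓ : (2 : ℝ) - ℓ ≠ 0 := by intro h; linarith
  have hc₂ : σ * ((1 - r) / (1 + r)) = s := by
    have h1 : (1 - r) / (1 + r) = ℓ / (2 - ℓ) := by rw [hrdef]; congr 1 <;> ring
    rw [h1, mul_div_assoc', div_eq_iff h2ℓ, hℓkey]
  have hc₁ : g₀ * ((1 - r₁) / (1 + r₁)) = s * ε' := by
    have h1 : (1 - r₁) / (1 + r₁) = lam * ℓ / (2 - lam * ℓ) := by rw [hr₁def]; congr 1 <;> ring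
    rw [h1, hcentre]
  have hz0 : z 0 = J x₀ + (I : ℂ) • J (s • k) := by
    rw [hzdef, tubeDisc_eq, hΦ₁im, hΦ₂im, hΦ₁re, hΦ₂re, peakKernel_zero_im, peakKernel_zero_im,
      peakKernel_zero_re, peakKernel_zero_re, mul_zero, mul_zero, zero_smul, zero_smul, sub_zero,
      sub_zero, hc₁, hc₂, hk'def, smul_sub, smul_smul]
    congr 2
    abel
  simpa [hz0] using hmax

end Literature.Analysis.Complex
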